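import Summits.NavierStokesRegularity.NavierStokesRegularity.Theorems.LerayQuarterDissipationFiniteDissipationLiouvilleTraceRecurrent
import Summits.NavierStokesRegularity.NavierStokesRegularity.Theorems.LerayQuarterDissipationFiniteDissipationLiouvilleTraceContinuity
import Summits.NavierStokesRegularity.NavierStokesRegularity.Theorems.LerayQuarterDissipationFiniteDissipationLiouvillePersistenceSeq
import HarnessLib

/-!
# Crux `FiniteDissipationLiouville` (stmt-NavierStokesRegularity-22144): ε-REGULARITY IN TERMS OF
# THE FINAL DATUM ALONE — a member of the stratum whose trace has trivial blow-ups at the apex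
# (e.g. lies in `L³` near the apex) is regular there

Theorems file of route `LerayQuarterDissipation` (lead prover g5; `--supports` the crux: an APEX
leaf bearing on BOTH registered stubs of the line `birth`, for EVERY member — past-DSS or
past-wandering). Navier–Stokes regularity is NOT proved by anything here; no summit is.

`𝒟_{C,K}`: Type-I ancient mild fields `u` (`IsTypeIAncientMild C u`) with the quarter-rate law
`∫ ‖∇u(s)‖² ≤ K/√(−s)`; `T_u(φ) = lim_{t→0⁻} ∫⟪u(t), φ⟫` the distributional trace at the apex
(lead g3). Lead g4 proved, FOR PAST-DSS MEMBERS ONLY (through the DSS-homogeneity of the trace),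
that a trace which is a bounded — or `L^p`, `p > 3` — function near the apex forces `u ≡ 0`
(`eq_zero_of_pastDss_of_trace_locallyBounded`, `eq_zero_of_pastDss_of_trace_lq_dual`).

**This file removes the DSS hypothesis and reaches the borderline exponent `p = 3`.**

* `not_singular_of_trace_blowup_small` — **THE APEX TRACE LEAF**: if the Navier–Stokes blow-ups
  `λ u₀(λ ·)`, `λ → 0⁺`, of the final datum at the apex tend to `0` in `𝒟'(ℝ³)` — for every test
  field `φ`, `λ⁻² T_u(φ(λ⁻¹ ·))` is eventually small as `λ → 0⁺` — then `u` is NOT singular at the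
  apex. Proof (blow-up + persistence + final-slice leaf): the parabolic blow-ups
  `u_k = nsRescale λ_k u`, `λ_k → 0`, of a singular member are singular members of `𝒟_{C,K}`
  (scale invariance); KNSS compactness across members (`Compactness.seqLimit`, p1) gives a limit
  member `W ∈ 𝒟_{C,K}`, singular at the apex (`persistent_singularity_seq`); the traces converge
  along the sequence (`tendsto_trace_of_tendsto_slices`, lead g3, from the UNIFORM trace rate) and
  the trace of `u_k` is the blow-up `λ_k u₀(λ_k ·)` (`tendsto_pairing_nsRescale`, this lead) — so
  `W` has ZERO trace, hence `W ≡ 0` by the final-slice leaf (`notSingular_of_tendsto_finalSlice`,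
  Lemarié-Rieusset Thm. 15.4): contradiction.
* `not_singular_of_trace_locallyBounded` — a member (ANY member) whose trace is a bounded function
  near the apex (`|T_u(ψ)| ≤ M ∫‖ψ‖` for `ψ` supported in `B(0, r₀)`) is regular at the apex.
* `not_singular_of_trace_L3_small` — **the sharp exponent**: if the trace has VANISHING
  `L³`-CONCENTRATION at the apex — for every `ε > 0` there is `ρ > 0` with
  `|T_u(ψ)| ≤ ε ‖ψ‖_{L^{3/2}}` for all test fields `ψ` supported in `B(0, ρ)` (e.g. `u₀ ∈ L³` on a
  neighbourhood of the apex, by absolute continuity; a fortiori `u₀ ∈ L^p`, `p > 3`, or bounded)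
  — then `u` is regular at the apex. The scaling is exactly critical:
  `‖φ(λ⁻¹ ·)‖_{L^{3/2}} = λ² ‖φ‖_{L^{3/2}}` cancels the `λ⁻²`.
* PORTRAIT (contrapositives `trace_L3_concentration_of_singular`,
  `trace_not_locallyBounded_of_singular`): **the final datum of every SINGULAR member of `𝒟` —
  DSS or wandering — concentrates in `L³` at the singular point: there is `ε₀ > 0` such that in
  EVERY ball `B(0, ρ)` some test field has `|T_u(ψ)| > ε₀ ‖ψ‖_{L^{3/2}}`; in particular the trace is
  in no `L^p(B(0, r₀))`, `p ≥ 3`, and is not bounded near the apex.** With lead g5's Morrey leaf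
  (`exists_trace_morrey_bound`: `u₀ ∈ M^{2,1}` with the scaling of `|x|⁻¹`) the final datum of a
  singular member sits exactly in the critical window `M^{2,1} ∖ L³_loc(apex)` — the window of the
  homogeneous profiles `a(x̂)|x|⁻¹ ∈ L^{3,∞} ∖ L³` of the DSS wall.

References: Koch–Nadirashvili–Seregin–Šverák, Acta Math. 203 (2009) = arXiv:0709.3599, §4
(compactness); Albritton–Barker, arXiv:1811.00502, Prop. 2.3 (persistence of singularities);
Lemarié-Rieusset (2016), Thm. 15.4 (backward uniqueness).
-/

noncomputable section

-- the summit and its single sub-problem share the name (CONVENTIONS §1), as in every Theorems file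
set_option linter.dupNamespace false

namespace Summit.NavierStokesRegularity.NavierStokesRegularity.Theorems.FiniteDissipationLiouville.Birth.Apex

open MeasureTheory Set Filter Topology Metric Function TopologicalSpace
open Literature.Analysis Literature.Analysis.FluidPDE
open scoped ENNReal NNReal RealInnerProductSpace

variable {C K : ℝ} {u : ℝ → EuclideanSpace ℝ (Fin 3) → EuclideanSpace ℝ (Fin 3)}

/-! ### The apex trace leaf -/

/-- **THE APEX TRACE LEAF: a member of the stratum whose final datum has trivial blow-ups at the
apex is regular at the apex.** Hypothesis (`hblow`): for every test field `φ` and `ε > 0` there is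
`λ₀ > 0` such that for `0 < λ < λ₀` the trace value `T` of `u` against the dilated field
`φ(λ⁻¹ ·)` satisfies `|λ⁻² T| ≤ ε` — i.e. the Navier–Stokes blow-ups `λ u₀(λ ·)` of the trace tend
to `0` in `𝒟'(ℝ³)` as `λ → 0⁺`. Conclusion: `u` is bounded on some backward cylinder at the origin.
Holds for EVERY member (no self-similarity assumed). -/
theorem not_singular_of_trace_blowup_small (hu : IsTypeIAncientMild C u)
    (hlaw : ∀ s : ℝ, s < 0 → ∫⁻ x, ‖fderiv ℝ (u s) x‖ₑ ^ 2 ≤ ENNReal.ofReal (K / Real.sqrt (-s)))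
    (hblow : ∀ φ : EuclideanSpace ℝ (Fin 3) → EuclideanSpace ℝ (Fin 3),
      FunctionSpaces.IsTestFunctionOn (⊤ : Opens (EuclideanSpace ℝ (Fin 3))) φ →
      ∀ ε > 0, ∃ lam₀ > 0, ∀ lam : ℝ, 0 < lam → lam < lam₀ →
        ∀ T : ℝ, Tendsto (fun t => ∫ x, ⟪u t x, φ (lam⁻¹ • x)⟫) (𝓝[<] 0) (𝓝 T) →
          |(lam ^ 2)⁻¹ * T| ≤ ε) :
    ¬ (∀ r > 0, ∀ M : ℝ, ∃ t ∈ Set.Ioo (-(r ^ 2)) (0 : ℝ),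
        ∃ x ∈ Metric.ball (0 : EuclideanSpace ℝ (Fin 3)) r, M < ‖u t x‖) := by
  intro hsing
  -- ### the blow-up sequence `u_k = nsRescale λ_k u`, `λ_k = 1/(k+2)`
  set lam : ℕ → ℝ := fun k => 1 / ((k : ℝ) + 2) with hlam
  have hlam0 : ∀ k, 0 < lam k := fun k => by rw [hlam]; positivity
  have hlamt : Tendsto lam atTop (𝓝 0) :=
    tendsto_const_nhds.div_atTop (tendsto_atTop_add_const_right _ _ tendsto_natCast_atTop_atTop)
  set w : ℕ → ℝ → EuclideanSpace ℝ (Fin 3) → EuclideanSpace ℝ (Fin 3) :=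
    fun k => nsRescale (lam k) u with hw
  have hwk : ∀ k, IsTypeIAncientMild C (w k) := fun k => hu.nsRescale (hlam0 k)
  have hlawk : ∀ k, ∀ s : ℝ, s < 0 →
      ∫⁻ x, ‖fderiv ℝ (w k s) x‖ₑ ^ 2 ≤ ENNReal.ofReal (K / Real.sqrt (-s)) :=
    fun k => RecurrentReductionD.dissipationLaw_nsRescale hlaw (hlam0 k)
  have hsingk : ∀ k, ∀ r > 0, ∀ M : ℝ, ∃ t ∈ Ioo (-(r ^ 2)) (0 : ℝ),
      ∃ x ∈ ball (0 : EuclideanSpace ℝ (Fin 3)) r, M < ‖w k t x‖ :=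
    fun k => RecurrentReductionD.singularAtOrigin_nsRescale hsing (hlam0 k)
  -- ### KNSS compactness across members: a singular limit member `W ∈ 𝒟_{C,K}`
  obtain ⟨ψ, hψ, W, hW, hunif, hpt, hgrad⟩ := Compactness.seqLimit hwk
  have hψt : Tendsto ψ atTop atTop := hψ.tendsto_atTop
  have hWlaw : ∀ s : ℝ, s < 0 →
      ∫⁻ x, ‖fderiv ℝ (W s) x‖ₑ ^ 2 ≤ ENNReal.ofReal (K / Real.sqrt (-s)) :=
    Compactness.law_of_seqLimit (Kinf := K) (Kk := fun _ => K) hψt hlawk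
      (fun ε hε => Eventually.of_forall fun _ => by linarith) hgrad
  have hWsing := Compactness.persistent_singularity_seq (w := fun j => w (ψ j))
    (fun j => hwk (ψ j)) (fun j => hlawk (ψ j)) (fun j => hsingk (ψ j)) hW hunif
  -- ### the trace of `W` vanishes
  refine notSingular_of_tendsto_finalSlice hW hWlaw (fun φ hφ => ?_) hWsing
  obtain ⟨L, hL⟩ := exists_tendsto_pairing_finalSlice hW hWlaw hφ
  suffices hL0 : L = 0 by rwa [hL0] at hL
  -- the trace values of `u` against the dilated fields `φ(λ_{ψ j}⁻¹ ·)`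
  have hex : ∀ j, ∃ Tl : ℝ,
      Tendsto (fun t => ∫ x, ⟪u t x, φ ((lam (ψ j))⁻¹ • x)⟫) (𝓝[<] 0) (𝓝 Tl) := fun j =>
    exists_tendsto_pairing_finalSlice hu hlaw (hφ.comp_smul_top (inv_ne_zero (hlam0 (ψ j)).ne'))
  choose Tl hTl using hex
  -- the traces of the blow-ups `w (ψ j)` are `λ⁻² Tl j`, and they converge to `L`
  have hLw : ∀ j, Tendsto (fun t => ∫ x, ⟪w (ψ j) t x, φ x⟫) (𝓝[<] 0)
      (𝓝 ((lam (ψ j) ^ 2)⁻¹ * Tl j)) := fun j =>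
    tendsto_pairing_nsRescale (hlam0 (ψ j)) (hTl j)
  have hconv : Tendsto (fun j => (lam (ψ j) ^ 2)⁻¹ * Tl j) atTop (𝓝 L) :=
    tendsto_trace_of_tendsto_slices hφ (fun j => hwk (ψ j)) (fun j => hlawk (ψ j)) hW hWlaw
      (fun t ht x => hpt t ht x) hLw hL
  -- but by `hblow` they tend to `0`
  have hzero : Tendsto (fun j => (lam (ψ j) ^ 2)⁻¹ * Tl j) atTop (𝓝 0) := by
    rw [Metric.tendsto_atTop]
    intro ε hε
    obtain ⟨lam₀, hlam₀, hsmall⟩ := hblow φ hφ (ε / 2) (half_pos hε)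
    have hev : ∀ᶠ j in atTop, lam (ψ j) < lam₀ :=
      (hlamt.comp hψt).eventually (gt_mem_nhds hlam₀)
    obtain ⟨N, hN⟩ := eventually_atTop.1 hev
    refine ⟨N, fun j hj => ?_⟩
    rw [Real.dist_eq, sub_zero]
    exact (hsmall (lam (ψ j)) (hlam0 (ψ j)) (hN j hj) (Tl j) (hTl j)).trans_lt (half_lt_self hε)
  exact tendsto_nhds_unique hconv hzero

/-! ### Bounded traces and `L³`-small traces at the apex -/

/-- Change of variables for the dilated test field: `∫ g(λ⁻¹ • x) dx = λ³ ∫ g`. -/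
theorem integral_comp_inv_smul_eq {g : EuclideanSpace ℝ (Fin 3) → ℝ} {lam : ℝ} (hlam : 0 < lam) :
    ∫ x, g (lam⁻¹ • x) = lam ^ 3 * ∫ x, g x := by
  have h := Measure.integral_comp_smul volume g lam⁻¹
  rw [finrank_euclideanSpace_fin, inv_pow, inv_inv, abs_of_pos (pow_pos hlam 3), smul_eq_mul] at h
  exact h

/-- The dilated test field `φ(λ⁻¹ ·)` is supported in `B(0, λ R)` when `φ` is supported in
`B(0, R)`. -/
theorem support_comp_inv_smul {φ : EuclideanSpace ℝ (Fin 3) → EuclideanSpace ℝ (Fin 3)}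
    {R lam : ℝ} (hlam : 0 < lam) (hR : ∀ x, φ x ≠ 0 → ‖x‖ < R) :
    ∀ x, φ (lam⁻¹ • x) ≠ 0 → ‖x‖ < lam * R := by
  intro x hx
  have h := hR _ hx
  rw [norm_smul, norm_inv, Real.norm_of_nonneg hlam.le] at h
  rwa [inv_mul_lt_iff₀ hlam] at h

/-- **A member of the stratum whose trace is a BOUNDED FUNCTION near the apex is regular at the
apex** — for EVERY member (lead g4's `not_singular_of_pastDss_of_trace_locallyBounded` assumed
past self-similarity): `|T_u(ψ)| ≤ M ∫‖ψ‖` for the test fields `ψ` supported in `B(0, r₀)` gives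
`|λ⁻² T_u(φ(λ⁻¹ ·))| ≤ M λ ∫‖φ‖ → 0`. -/
theorem not_singular_of_trace_locallyBounded (hu : IsTypeIAncientMild C u)
    (hlaw : ∀ s : ℝ, s < 0 → ∫⁻ x, ‖fderiv ℝ (u s) x‖ₑ ^ 2 ≤ ENNReal.ofReal (K / Real.sqrt (-s)))
    {r₀ M : ℝ} (hr₀ : 0 < r₀)
    (hbd : ∀ ψ : EuclideanSpace ℝ (Fin 3) → EuclideanSpace ℝ (Fin 3),
      FunctionSpaces.IsTestFunctionOn (⊤ : Opens (EuclideanSpace ℝ (Fin 3))) ψ →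
      (∀ x, ψ x ≠ 0 → ‖x‖ < r₀) →
      ∀ T : ℝ, Tendsto (fun t => ∫ x, ⟪u t x, ψ x⟫) (𝓝[<] 0) (𝓝 T) → |T| ≤ M * ∫ x, ‖ψ x‖) :
    ¬ (∀ r > 0, ∀ M' : ℝ, ∃ t ∈ Set.Ioo (-(r ^ 2)) (0 : ℝ),
        ∃ x ∈ Metric.ball (0 : EuclideanSpace ℝ (Fin 3)) r, M' < ‖u t x‖) := by
  refine not_singular_of_trace_blowup_small hu hlaw fun φ hφ ε hε => ?_
  obtain ⟨R, hR0, hR⟩ := hφ.hasCompactSupport.isCompact.isBounded.subset_ball_lt 0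
    (0 : EuclideanSpace ℝ (Fin 3))
  have hsuppφ : ∀ x, φ x ≠ 0 → ‖x‖ < R := fun x hx => by
    have h := hR (subset_tsupport _ (Function.mem_support.2 hx))
    rwa [mem_ball_zero_iff] at h
  set I : ℝ := ∫ x, ‖φ x‖ with hI
  have hI0 : 0 ≤ I := integral_nonneg fun _ => norm_nonneg _
  -- `M ≥ 0` may be assumed
  have hM0 : 0 ≤ max M 0 := le_max_right _ _
  refine ⟨min (r₀ / R) (ε / (max M 0 * I + 1)), lt_min (div_pos hr₀ hR0) (by positivity),
    fun lam hlam hlamlt T hT => ?_⟩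
  have hlam1 : lam < r₀ / R := lt_of_lt_of_le hlamlt (min_le_left _ _)
  have hlam2 : lam < ε / (max M 0 * I + 1) := lt_of_lt_of_le hlamlt (min_le_right _ _)
  -- the dilated field is supported in `B(0, λR) ⊆ B(0, r₀)`
  have hsupp : ∀ x, φ (lam⁻¹ • x) ≠ 0 → ‖x‖ < r₀ := fun x hx => by
    have h := support_comp_inv_smul hlam hsuppφ x hx
    have : lam * R < r₀ := (lt_div_iff₀ hR0).1 hlam1
    linarith
  have hTb := hbd _ (hφ.comp_smul_top (inv_ne_zero hlam.ne')) hsupp T hT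
  rw [integral_comp_inv_smul_eq (g := fun x => ‖φ x‖) hlam] at hTb
  have hlam2' : 0 < lam ^ 2 := by positivity
  calc |(lam ^ 2)⁻¹ * T| = (lam ^ 2)⁻¹ * |T| := by
        rw [abs_mul, abs_of_pos (inv_pos.2 hlam2')]
    _ ≤ (lam ^ 2)⁻¹ * (max M 0 * (lam ^ 3 * I)) := by
        refine mul_le_mul_of_nonneg_left (hTb.trans ?_) (inv_nonneg.2 hlam2'.le)
        exact mul_le_mul_of_nonneg_right (le_max_left _ _) (by positivity)
    _ = lam * (max M 0 * I) := by field_simp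
    _ ≤ ε := by
        have h1 : lam * (max M 0 * I + 1) < ε := (lt_div_iff₀ (by positivity)).1 hlam2
        nlinarith [mul_nonneg hM0 hI0]

/-- **THE SHARP EXPONENT: a member of the stratum whose trace has vanishing `L³`-concentration at
the apex is regular at the apex.** If for every `ε > 0` there is `ρ > 0` with
`|T_u(ψ)| ≤ ε ‖ψ‖_{L^{3/2}}` for all test fields `ψ` supported in `B(0, ρ)` — the distributional
form of "`u₀ ∈ L³` near the apex with `‖u₀‖_{L³(B(0,ρ))} → 0`", automatic for `u₀ ∈ L³(B(0, r₀))`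
and a fortiori for `u₀ ∈ L^p(B(0, r₀))`, `p > 3` — then `u` is NOT singular at the apex. The
dilation is exactly `L^{3/2}`-critical: `‖φ(λ⁻¹ ·)‖_{L^{3/2}} = λ² ‖φ‖_{L^{3/2}}`. -/
theorem not_singular_of_trace_L3_small (hu : IsTypeIAncientMild C u)
    (hlaw : ∀ s : ℝ, s < 0 → ∫⁻ x, ‖fderiv ℝ (u s) x‖ₑ ^ 2 ≤ ENNReal.ofReal (K / Real.sqrt (-s)))
    (hL3 : ∀ ε > 0, ∃ ρ > 0, ∀ ψ : EuclideanSpace ℝ (Fin 3) → EuclideanSpace ℝ (Fin 3),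
      FunctionSpaces.IsTestFunctionOn (⊤ : Opens (EuclideanSpace ℝ (Fin 3))) ψ →
      (∀ x, ψ x ≠ 0 → ‖x‖ < ρ) →
      ∀ T : ℝ, Tendsto (fun t => ∫ x, ⟪u t x, ψ x⟫) (𝓝[<] 0) (𝓝 T) →
        |T| ≤ ε * (∫ x, ‖ψ x‖ ^ (3 / 2 : ℝ)) ^ (2 / 3 : ℝ)) :
    ¬ (∀ r > 0, ∀ M' : ℝ, ∃ t ∈ Set.Ioo (-(r ^ 2)) (0 : ℝ),
        ∃ x ∈ Metric.ball (0 : EuclideanSpace ℝ (Fin 3)) r, M' < ‖u t x‖) := by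
  refine not_singular_of_trace_blowup_small hu hlaw fun φ hφ ε hε => ?_
  obtain ⟨R, hR0, hR⟩ := hφ.hasCompactSupport.isCompact.isBounded.subset_ball_lt 0
    (0 : EuclideanSpace ℝ (Fin 3))
  have hsuppφ : ∀ x, φ x ≠ 0 → ‖x‖ < R := fun x hx => by
    have h := hR (subset_tsupport _ (Function.mem_support.2 hx))
    rwa [mem_ball_zero_iff] at h
  set I : ℝ := ∫ x, ‖φ x‖ ^ (3 / 2 : ℝ) with hI
  have hI0 : 0 ≤ I := integral_nonneg fun _ => Real.rpow_nonneg (norm_nonneg _) _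
  have hJ0 : 0 ≤ I ^ (2 / 3 : ℝ) := Real.rpow_nonneg hI0 _
  -- smallness `ε' = ε / (I^{2/3} + 1)` at the apex
  obtain ⟨ρ, hρ, hsmall⟩ := hL3 (ε / (I ^ (2 / 3 : ℝ) + 1)) (by positivity)
  refine ⟨ρ / R, div_pos hρ hR0, fun lam hlam hlamlt T hT => ?_⟩
  have hsupp : ∀ x, φ (lam⁻¹ • x) ≠ 0 → ‖x‖ < ρ := fun x hx => by
    have h := support_comp_inv_smul hlam hsuppφ x hx
    have : lam * R < ρ := (lt_div_iff₀ hR0).1 hlamlt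
    linarith
  have hTb := hsmall _ (hφ.comp_smul_top (inv_ne_zero hlam.ne')) hsupp T hT
  rw [integral_comp_inv_smul_eq (g := fun x => ‖φ x‖ ^ (3 / 2 : ℝ)) hlam] at hTb
  -- `(λ³ I)^{2/3} = λ² I^{2/3}`
  have hpow : (lam ^ 3 * I) ^ (2 / 3 : ℝ) = lam ^ 2 * I ^ (2 / 3 : ℝ) := by
    rw [Real.mul_rpow (pow_nonneg hlam.le 3) hI0]
    congr 1
    rw [← Real.rpow_natCast lam 3, ← Real.rpow_mul hlam.le]
    norm_num
  rw [hpow] at hTb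
  have hlam2' : 0 < lam ^ 2 := by positivity
  calc |(lam ^ 2)⁻¹ * T| = (lam ^ 2)⁻¹ * |T| := by
        rw [abs_mul, abs_of_pos (inv_pos.2 hlam2')]
    _ ≤ (lam ^ 2)⁻¹ * (ε / (I ^ (2 / 3 : ℝ) + 1) * (lam ^ 2 * I ^ (2 / 3 : ℝ))) :=
        mul_le_mul_of_nonneg_left hTb (inv_nonneg.2 hlam2'.le)
    _ = ε / (I ^ (2 / 3 : ℝ) + 1) * I ^ (2 / 3 : ℝ) := by field_simp
    _ ≤ ε := by
        rw [div_mul_eq_mul_div, div_le_iff₀ (by positivity)]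
        nlinarith

/-! ### Portrait: the final datum of a singular member concentrates in `L³` at the apex -/

/-- **PORTRAIT ENTRY (both stubs): the trace of a SINGULAR member of the stratum has
NON-VANISHING `L³`-CONCENTRATION at the singular point** — there is `ε₀ > 0` such that in every
ball `B(0, ρ)` some test field `ψ` has a trace value with `|T| > ε₀ ‖ψ‖_{L^{3/2}}`. In particular
the final datum is in no `L^p(B(0, r₀))`, `p ≥ 3` (the DSS profiles `a(x̂)|x|⁻¹ ∈ L^{3,∞} ∖ L³`
saturate this). -/
theorem trace_L3_concentration_of_singular (hu : IsTypeIAncientMild C u)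
    (hlaw : ∀ s : ℝ, s < 0 → ∫⁻ x, ‖fderiv ℝ (u s) x‖ₑ ^ 2 ≤ ENNReal.ofReal (K / Real.sqrt (-s)))
    (hsing : ∀ r > 0, ∀ M' : ℝ, ∃ t ∈ Set.Ioo (-(r ^ 2)) (0 : ℝ),
      ∃ x ∈ Metric.ball (0 : EuclideanSpace ℝ (Fin 3)) r, M' < ‖u t x‖) :
    ∃ ε > 0, ∀ ρ > 0, ∃ (ψ : EuclideanSpace ℝ (Fin 3) → EuclideanSpace ℝ (Fin 3)) (T : ℝ),
      FunctionSpaces.IsTestFunctionOn (⊤ : Opens (EuclideanSpace ℝ (Fin 3))) ψ ∧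
        (∀ x, ψ x ≠ 0 → ‖x‖ < ρ) ∧
        Tendsto (fun t => ∫ x, ⟪u t x, ψ x⟫) (𝓝[<] 0) (𝓝 T) ∧
        ε * (∫ x, ‖ψ x‖ ^ (3 / 2 : ℝ)) ^ (2 / 3 : ℝ) < |T| := by
  by_contra h
  push Not at h
  refine not_singular_of_trace_L3_small hu hlaw (fun ε hε => ?_) hsing
  obtain ⟨ρ, hρ, hh⟩ := h ε hε
  exact ⟨ρ, hρ, fun ψ hψ hs T hT => hh ψ T hψ hs hT⟩

/-- **PORTRAIT ENTRY: the trace of a singular member of the stratum is NOT a bounded function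
near the apex** (for every member; lead g4 had it for past-DSS members). -/
theorem trace_not_locallyBounded_of_singular (hu : IsTypeIAncientMild C u)
    (hlaw : ∀ s : ℝ, s < 0 → ∫⁻ x, ‖fderiv ℝ (u s) x‖ₑ ^ 2 ≤ ENNReal.ofReal (K / Real.sqrt (-s)))
    (hsing : ∀ r > 0, ∀ M' : ℝ, ∃ t ∈ Set.Ioo (-(r ^ 2)) (0 : ℝ),
      ∃ x ∈ Metric.ball (0 : EuclideanSpace ℝ (Fin 3)) r, M' < ‖u t x‖)
    {r₀ : ℝ} (hr₀ : 0 < r₀) (M : ℝ) :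
    ∃ (ψ : EuclideanSpace ℝ (Fin 3) → EuclideanSpace ℝ (Fin 3)) (T : ℝ),
      FunctionSpaces.IsTestFunctionOn (⊤ : Opens (EuclideanSpace ℝ (Fin 3))) ψ ∧
        (∀ x, ψ x ≠ 0 → ‖x‖ < r₀) ∧
        Tendsto (fun t => ∫ x, ⟪u t x, ψ x⟫) (𝓝[<] 0) (𝓝 T) ∧ M * ∫ x, ‖ψ x‖ < |T| := by
  by_contra h
  push Not at h
  exact not_singular_of_trace_locallyBounded hu hlaw hr₀ (M := M)
    (fun ψ hψ hs T hT => h ψ T hψ hs hT) hsing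

/-! ### Bookkeeping: the crux lives on members whose trace concentrates in `L³` at the apex -/

/-- **The crux is equivalent to its restriction to members whose final datum has non-vanishing
`L³`-concentration at the apex** (members failing this are regular there, by the apex trace
leaf). -/
theorem finiteDissipationLiouville_iff_L3concentration :
    Theses.LerayQuarterDissipation.FiniteDissipationLiouville ↔
      ∀ (C K : ℝ) (ū : ℝ → EuclideanSpace ℝ (Fin 3) → EuclideanSpace ℝ (Fin 3)),
        IsTypeIAncientMild C ū →
        (∀ s : ℝ, s < 0 → ∫⁻ x, ‖fderiv ℝ (ū s) x‖ₑ ^ 2 ≤ ENNReal.ofReal (K / Real.sqrt (-s))) →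
        (∃ ε > 0, ∀ ρ > 0, ∃ (ψ : EuclideanSpace ℝ (Fin 3) → EuclideanSpace ℝ (Fin 3)) (T : ℝ),
          FunctionSpaces.IsTestFunctionOn (⊤ : Opens (EuclideanSpace ℝ (Fin 3))) ψ ∧
            (∀ x, ψ x ≠ 0 → ‖x‖ < ρ) ∧
            Tendsto (fun t => ∫ x, ⟪ū t x, ψ x⟫) (𝓝[<] 0) (𝓝 T) ∧
            ε * (∫ x, ‖ψ x‖ ^ (3 / 2 : ℝ)) ^ (2 / 3 : ℝ) < |T|) →
        ¬ (∀ r > 0, ∀ M : ℝ, ∃ t ∈ Set.Ioo (-(r ^ 2)) (0 : ℝ),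
            ∃ x ∈ Metric.ball (0 : EuclideanSpace ℝ (Fin 3)) r, M < ‖ū t x‖) := by
  constructor
  · intro h C K ū hū hD _
    exact h C K ū hū hD
  · intro h C K ū hū hD hsing
    exact h C K ū hū hD (trace_L3_concentration_of_singular hū hD hsing) hsing

end Summit.NavierStokesRegularity.NavierStokesRegularity.Theorems.FiniteDissipationLiouville.Birth.Apex

end
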